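import Literature.Geometry.Manifold.SubmersionLift
import Literature.Geometry.Manifold.IntegralCurveInvariantSets
import HarnessLib

/-!
# Lifting vectors through a submersion tangentially to straightened closed sets

General differential topology, serving the relative form of Ehresmann's fibration theorem
(Dimca 1992, Ch. 1, Prop. (3.1), second part, and — for several submanifolds crossing normally —
the simplest instance of Thom's first isotopy lemma, Thm. (3.5): the trivialising flows respect a
closed submanifold `A` on which the map is still a submersion). In the proof of Ehresmann's
theorem (Bröcker–Jänich 1982, (8.12); the tree's `Literature.Geometry.Manifold.SubmersionLift`,
`…ProperSubmersionTrivial`) the basic fields of the base are lifted through the submersion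
`g : N → F` and glued by a partition of unity. Here the lifts are in addition made **tangent** to
a finite family of closed subsets `D j ⊆ N` which are *straightened, compatibly with `g`, by
adapted charts*: about every point `x` there is an open partial homeomorphism
`φ x : N ⇀ F × F''`, `C^∞` with `C^∞` inverse, in which `g` depends on the first coordinate only
(`g (φ⁻¹(a, b)) = g (φ⁻¹(a, b'))`) and each `D j` is either absent or a product `F × L` with `L`
a linear subspace of `F''` (for a submersion `g` and submanifolds `D j` crossing normally along
which `g` restricts to submersions, such charts are the adapted coordinates of the submersion
normal form).

* `fderiv_comp_symm_apply_zero_eq_zero` — in an adapted chart the derivative of `g` kills the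
  fibre directions `(0, b)`;
* `exists_local_lift_tangent` — local lifts with vanishing fibre components in a given adapted
  chart (take any local lift, `exists_local_lift_of_surjective_mfderiv`, read it in the chart and
  delete its fibre component: the derivative of `g` does not see the difference);
* `exists_contMDiff_lift_tangent` — **global `C^∞` lifts `X` of a vector `c` (`dg (X x) = c`)
  tangent to all the `D j`**: `dφ(X y) ∈ F × L` whenever `φ` is one of the adapted charts,
  `D j = φ⁻¹(F × L)` on its source and `y ∈ D j` (the conditions are convex in `X y`; tangency
  does not depend on the adapted chart used to express it,
  `Literature.Geometry.Manifold.mfderiv_mem_of_straightened`; glue by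
  `exists_contMDiffSection_forall_mem_convex_of_local`).

Everything is proved; no definitions.

## References

* A. Dimca, *Singularities and Topology of Hypersurfaces*, Universitext, Springer 1992, Ch. 1,
  Prop. (3.1) and Thm. (3.5) (held: `lit read book:dimca1992-singularities-topology-hypersurfaces`,
  PDF p. 28). [Dimca1992]
* Th. Bröcker, K. Jänich, *Introduction to Differential Topology*, CUP 1982, proof of (8.12).
  [BrockerJanichIDT1982]
-/

open scoped Manifold ContDiff Topology
open Set Function Filter Bundle

noncomputable section

namespace Literature.Geometry.Manifold

universe u v

section TangentLift

variable {EN : Type u} [NormedAddCommGroup EN] [NormedSpace ℝ EN] [FiniteDimensional ℝ EN]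
  {H : Type v} [TopologicalSpace H] {I : ModelWithCorners ℝ EN H} [I.Boundaryless]
  {N : Type*} [TopologicalSpace N] [ChartedSpace H N] [IsManifold I ∞ N]
  {F : Type*} [NormedAddCommGroup F] [NormedSpace ℝ F] [FiniteDimensional ℝ F]
  {F'' : Type*} [NormedAddCommGroup F''] [NormedSpace ℝ F''] [FiniteDimensional ℝ F'']
  {g : N → F}

omit [FiniteDimensional ℝ EN] [I.Boundaryless] [IsManifold I ∞ N] [FiniteDimensional ℝ F]
  [FiniteDimensional ℝ F''] in
/-- **In an adapted chart the derivative of `g` kills the fibre directions.** If `g ∘ ψ⁻¹` depends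
only on the first coordinate on the target of the open partial homeomorphism `ψ : N ⇀ F × F''`,
then wherever `g ∘ ψ⁻¹` is differentiable its derivative vanishes on the vectors `(0, b)` (the
function is constant on the fibre `{a} × F''` near the point). [folklore] -/
theorem fderiv_comp_symm_apply_zero_eq_zero (ψ : OpenPartialHomeomorph N (F × F''))
    (hg' : ∀ v ∈ ψ.target, ∀ w ∈ ψ.target, v.1 = w.1 → g (ψ.symm v) = g (ψ.symm w))
    {z : F × F''} (hz : z ∈ ψ.target) (hd : DifferentiableAt ℝ (g ∘ ψ.symm) z) (b : F'') :
    fderiv ℝ (g ∘ ψ.symm) z ((0 : F), b) = 0 := by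
  set G : F × F'' → F := g ∘ ψ.symm with hG
  have hline : HasLineDerivAt ℝ G (fderiv ℝ G z ((0 : F), b)) z ((0 : F), b) :=
    hd.hasFDerivAt.hasLineDerivAt _
  rw [HasLineDerivAt] at hline
  -- the function `t ↦ G (z + t • (0, b))` is constant near `0`
  have hev : ∀ᶠ t : ℝ in 𝓝 0, G (z + t • ((0 : F), b)) = G z := by
    have hc : Continuous fun t : ℝ => z + t • ((0 : F), b) := by fun_prop
    have hmem : ∀ᶠ t : ℝ in 𝓝 0, z + t • ((0 : F), b) ∈ ψ.target :=
      hc.continuousAt.preimage_mem_nhds (by simpa using ψ.open_target.mem_nhds hz)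
    filter_upwards [hmem] with t ht
    exact hg' _ ht _ hz (by simp)
  have hconst : HasDerivAt (fun t : ℝ => G (z + t • ((0 : F), b))) 0 0 :=
    (hasDerivAt_const (0 : ℝ) (G z)).congr_of_eventuallyEq hev
  exact hline.unique hconst

-- the tangent spaces of the model vector spaces are the vector spaces themselves by definition,
-- which the derivative lemmas for maps between vector spaces must see through
set_option backward.isDefEq.respectTransparency false in
/-- **Local lifts with vanishing fibre components in an adapted chart.** Let `g : N → F` be `C^∞`
with `mfderiv g x₀` onto, and let `ψ : N ⇀ F × F''` be an open partial homeomorphism at `x₀`, `C^∞`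
with `C^∞` inverse, in which `g` depends on the first coordinate only. Then for every `c : F`
there is, on a neighbourhood `U ⊆ source ψ` of `x₀`, a `C^∞` vector field `X` with
`mfderiv g x (X x) = c` and `dψ(X x) ∈ F × {0}` for `x ∈ U`. Construction: read a local lift `X₀`
(`exists_local_lift_of_surjective_mfderiv`) in the chart, delete its second component, and pull
back; `dg` does not see the deleted component (`fderiv_comp_symm_apply_zero_eq_zero`).
[cite: Dimca1992, Ch. 1 Prop. (3.1) (proof)] -/
theorem exists_local_lift_tangent (hg : ContMDiff I 𝓘(ℝ, F) ∞ g) {x₀ : N}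
    (hsurj : Surjective (mfderiv I 𝓘(ℝ, F) g x₀)) (ψ : OpenPartialHomeomorph N (F × F''))
    (hx₀ : x₀ ∈ ψ.source) (hψ : ContMDiffOn I 𝓘(ℝ, F × F'') ∞ ψ ψ.source)
    (hψs : ContMDiffOn 𝓘(ℝ, F × F'') I ∞ ψ.symm ψ.target)
    (hg' : ∀ v ∈ ψ.target, ∀ w ∈ ψ.target, v.1 = w.1 → g (ψ.symm v) = g (ψ.symm w)) (c : F) :
    ∃ U ∈ 𝓝 x₀, ∃ X : Π x : N, TangentSpace I x,
      ContMDiffOn I I.tangent ∞ (fun x => (⟨x, X x⟩ : TangentBundle I N)) U ∧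
      (∀ x ∈ U, mfderiv I 𝓘(ℝ, F) g x (X x) = c) ∧ U ⊆ ψ.source ∧
      ∀ x ∈ U, (mfderiv I 𝓘(ℝ, F × F'') ψ x (X x)).2 = 0 := by
  haveI : CompleteSpace EN := FiniteDimensional.complete ℝ EN
  have htop : (∞ : WithTop ℕ∞) ≠ 0 := by simp
  obtain ⟨U₀, hU₀, X₀, hX₀s, hX₀c⟩ := exists_local_lift_of_surjective_mfderiv hg hsurj c
  -- an open neighbourhood inside the source of the chart
  set U : Set N := interior U₀ ∩ ψ.source with hU
  have hUo : IsOpen U := isOpen_interior.inter ψ.open_source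
  have hx₀U : x₀ ∈ U := ⟨mem_interior_iff_mem_nhds.2 hU₀, hx₀⟩
  have hUU₀ : U ⊆ U₀ := fun x hx => interior_subset hx.1
  -- the projection deleting the fibre component
  set Q : F × F'' →L[ℝ] F × F'' :=
    (ContinuousLinearMap.inl ℝ F F'').comp (ContinuousLinearMap.fst ℝ F F'') with hQ
  have hQapply : ∀ w : F × F'', Q w = (w.1, 0) := fun w => rfl
  -- the local lift read in the chart, and its projection
  set W₀ : F × F'' → F × F'' := VectorField.mpullback 𝓘(ℝ, F × F'') I ψ.symm X₀ with hW₀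
  have hW₀eq : ∀ z ∈ ψ.target,
      W₀ z = mfderiv I 𝓘(ℝ, F × F'') ψ (ψ.symm z) (X₀ (ψ.symm z)) := by
    intro z hz
    rw [hW₀, VectorField.mpullback_apply, (inverse_mfderiv_symm_eq htop hψ hψs hz).2]
    rfl
  set W : F × F'' → F × F'' := fun z => Q (W₀ z) with hW
  -- the candidate: the pull-back of `W` by the chart
  set X : Π x : N, TangentSpace I x := VectorField.mpullback I 𝓘(ℝ, F × F'') ψ W with hX
  -- the set of chart values over `U`
  set s : Set (F × F'') := ψ.target ∩ ψ.symm ⁻¹' U with hs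
  have hso : IsOpen s := ψ.isOpen_inter_preimage_symm hUo
  have hUs : U ⊆ ψ ⁻¹' s := fun x hx =>
    ⟨ψ.map_source hx.2, by rw [mem_preimage, ψ.left_inv hx.2]; exact hx⟩
  -- smoothness of `W` on `s`
  have hW₀s : ∀ z ∈ s, ContMDiffWithinAt 𝓘(ℝ, F × F'') 𝓘(ℝ, F × F'').tangent ∞
      (fun z => (⟨z, W₀ z⟩ : TangentBundle 𝓘(ℝ, F × F'') (F × F''))) s z := by
    intro z hz
    have h1 : ContMDiffWithinAt I I.tangent ∞ (fun x => (⟨x, X₀ x⟩ : TangentBundle I N)) U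
        (ψ.symm z) := (hX₀s _ (hUU₀ hz.2)).mono hUU₀
    have h2 := ContMDiffWithinAt.mpullback_vectorField_preimage (n := ∞) h1
      (hψs.contMDiffAt (ψ.open_target.mem_nhds hz.1))
      (inverse_mfderiv_symm_eq htop hψ hψs hz.1).1 (by norm_cast)
    exact h2.mono fun w hw => hw.2
  have hWs : ∀ z ∈ s, ContMDiffWithinAt 𝓘(ℝ, F × F'') 𝓘(ℝ, F × F'').tangent ∞
      (fun z => (⟨z, W z⟩ : TangentBundle 𝓘(ℝ, F × F'') (F × F''))) s z := by
    intro z hz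
    have h1 : ContDiffWithinAt ℝ ∞ W₀ s z :=
      contMDiffWithinAt_vectorSpace_iff_contDiffWithinAt.1 (hW₀s z hz)
    have h2 : ContDiffWithinAt ℝ ∞ W s z := Q.contDiff.comp_contDiffWithinAt h1
    exact contMDiffWithinAt_vectorSpace_iff_contDiffWithinAt.2 h2
  refine ⟨U, hUo.mem_nhds hx₀U, X, fun x hx => ?_, fun x hx => ?_, inter_subset_right,
    fun x hx => ?_⟩
  · -- smoothness of `X` at `x ∈ U`
    have h1 : ContMDiffWithinAt I I.tangent ∞ (fun x => (⟨x, X x⟩ : TangentBundle I N))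
        (ψ ⁻¹' s) x :=
      ContMDiffWithinAt.mpullback_vectorField_preimage (n := ∞) (hWs _ (hUs hx))
        (hψ.contMDiffAt (ψ.open_source.mem_nhds hx.2))
        (isInvertible_mfderiv_of_contMDiffOn_symm htop hψ hψs hx.2) (by norm_cast)
    exact h1.mono hUs
  · -- `dg (X x) = c`
    have hz : ψ x ∈ ψ.target := ψ.map_source hx.2
    -- `g` read in the chart and its derivative
    set G : F × F'' → F := g ∘ ψ.symm with hG
    have hGs : ContDiffOn ℝ ∞ G ψ.target :=
      contMDiffOn_iff_contDiffOn.1 (hg.comp_contMDiffOn hψs)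
    have hGd : HasFDerivAt G (fderiv ℝ G (ψ x)) (ψ x) :=
      ((hGs.differentiableOn (by simp)) _ hz).differentiableAt (ψ.open_target.mem_nhds hz)
        |>.hasFDerivAt
    -- chain rule: `dg = dG ∘ dψ` at `x`
    have h1 : HasMFDerivAt I 𝓘(ℝ, F × F'') ψ x (mfderiv I 𝓘(ℝ, F × F'') ψ x) :=
      ((hψ.mdifferentiableOn htop x hx.2).mdifferentiableAt
        (ψ.open_source.mem_nhds hx.2)).hasMFDerivAt
    have h2 : HasMFDerivAt 𝓘(ℝ, F × F'') 𝓘(ℝ, F) G (ψ x) (fderiv ℝ G (ψ x)) :=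
      hasMFDerivAt_iff_hasFDerivAt.2 hGd
    have h3 := h2.comp x h1
    have heq : G ∘ ψ =ᶠ[𝓝 x] g := by
      filter_upwards [ψ.open_source.mem_nhds hx.2] with w hw
      show g (ψ.symm (ψ w)) = g w
      rw [ψ.left_inv hw]
    have h4 : mfderiv I 𝓘(ℝ, F) g x =
        (fderiv ℝ G (ψ x)).comp (mfderiv I 𝓘(ℝ, F × F'') ψ x) :=
      (h3.congr_of_eventuallyEq heq.symm).mfderiv
    -- `dψ (X x) = W (ψ x)`
    have hinv := isInvertible_mfderiv_of_contMDiffOn_symm htop hψ hψs hx.2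
    have h5 : mfderiv I 𝓘(ℝ, F × F'') ψ x (X x) = W (ψ x) := by
      rw [hX, VectorField.mpullback_apply]
      exact hinv.self_apply_inverse _
    -- `dG` does not see the deleted fibre component
    have h6 : fderiv ℝ G (ψ x) (W (ψ x)) = fderiv ℝ G (ψ x) (W₀ (ψ x)) := by
      have hsplit : W₀ (ψ x) = W (ψ x) + ((0 : F), (W₀ (ψ x)).2) := by
        rw [hW]
        change W₀ (ψ x) = Q (W₀ (ψ x)) + ((0 : F), (W₀ (ψ x)).2)
        rw [hQapply, Prod.mk_add_mk, add_zero, zero_add]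
        rfl
      rw [hsplit, map_add, fderiv_comp_symm_apply_zero_eq_zero ψ hg' hz hGd.differentiableAt,
        add_zero]
    -- and `dG (W₀ (ψ x)) = dg (X₀ x) = c`
    have hcongr : ∀ a b : N, a = b →
        (fderiv ℝ G (ψ x)) (mfderiv I 𝓘(ℝ, F × F'') ψ a (X₀ a)) =
          (fderiv ℝ G (ψ x)) (mfderiv I 𝓘(ℝ, F × F'') ψ b (X₀ b)) := by
      rintro a b rfl
      rfl
    have h7 : fderiv ℝ G (ψ x) (W₀ (ψ x)) = mfderiv I 𝓘(ℝ, F) g x (X₀ x) := by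
      rw [hW₀eq _ hz, h4]
      exact hcongr _ _ (ψ.left_inv hx.2)
    rw [h4]
    change fderiv ℝ G (ψ x) (mfderiv I 𝓘(ℝ, F × F'') ψ x (X x)) = c
    rw [h5, h6, h7]
    exact hX₀c x (hUU₀ hx)
  · -- the fibre component of `dψ (X x)` vanishes
    have hinv := isInvertible_mfderiv_of_contMDiffOn_symm htop hψ hψs hx.2
    have h5 : mfderiv I 𝓘(ℝ, F × F'') ψ x (X x) = W (ψ x) := by
      rw [hX, VectorField.mpullback_apply]
      exact hinv.self_apply_inverse _
    rw [h5]
    rfl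

omit [FiniteDimensional ℝ EN] [I.Boundaryless] [IsManifold I ∞ N] [FiniteDimensional ℝ F]
  [FiniteDimensional ℝ F''] in
/-- In the situation of the adapted charts, a point of `D j ∩ source (φ x)` forces the second
alternative: `D j` is straightened on `source (φ x)`. [folklore] -/
theorem exists_straightening_of_mem {ι : Type*} {D : ι → Set N}
    {φ : N → OpenPartialHomeomorph N (F × F'')}
    (hD : ∀ x j, D j ∩ (φ x).source = ∅ ∨ ∃ L : Submodule ℝ F'',
      D j ∩ (φ x).source = (φ x).source ∩
        (φ x) ⁻¹' ((⊤ : Submodule ℝ F).prod L : Set (F × F''))) {x y : N} {j : ι}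
    (hy : y ∈ D j) (hyx : y ∈ (φ x).source) :
    ∃ L : Submodule ℝ F'', D j ∩ (φ x).source = (φ x).source ∩
      (φ x) ⁻¹' ((⊤ : Submodule ℝ F).prod L : Set (F × F'')) := by
  rcases hD x j with h | h
  · exfalso
    have hmem : y ∈ D j ∩ (φ x).source := ⟨hy, hyx⟩
    rw [h] at hmem
    exact hmem
  · exact h

variable [T2Space N] [SigmaCompactSpace N]

-- the fibres of the tangent bundle are the model vector space by definition
set_option backward.isDefEq.respectTransparency false in
/-- **Lifting a vector through a submersion, tangentially to straightened closed sets.** Let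
`g : N → F` be `C^∞` on a `σ`-compact Hausdorff `C^∞` manifold without boundary with
`mfderiv g x` onto for all `x`, and let `D j ⊆ N` be closed sets straightened, compatibly with `g`,
by adapted charts `φ x : N ⇀ F × F''` (`x ∈ source (φ x)`; `C^∞` with `C^∞` inverse; `g ∘ (φ x)⁻¹`
depends on the first coordinate only; on `source (φ x)` each `D j` is empty or `(φ x)⁻¹(F × L)`
for a linear subspace `L`). Then every `c : F` has a `C^∞` lift `X` (`mfderiv g x (X x) = c`)
which is **tangent to every `D j` in every adapted chart**: `d(φ x)(X y) ∈ F × L` whenever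
`D j ∩ source (φ x) = (φ x)⁻¹(F × L)` and `y ∈ D j ∩ source (φ x)`. (Local lifts with zero fibre
components in one adapted chart, `exists_local_lift_tangent`, are tangent in every adapted chart by
`mfderiv_mem_of_straightened`; the conditions being convex in `X y`, the local lifts glue by a
partition of unity, `exists_contMDiffSection_forall_mem_convex_of_local`.)
[cite: Dimca1992, Ch. 1 Prop. (3.1) (proof) and Thm. (3.5)]
[cite: BrockerJanichIDT1982, (8.12) (proof, lifting the basic fields)] -/
theorem exists_contMDiff_lift_tangent (hg : ContMDiff I 𝓘(ℝ, F) ∞ g)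
    (hsurj : ∀ x, Surjective (mfderiv I 𝓘(ℝ, F) g x)) {ι : Type*} (D : ι → Set N)
    (φ : N → OpenPartialHomeomorph N (F × F'')) (hmem : ∀ x, x ∈ (φ x).source)
    (hφ : ∀ x, ContMDiffOn I 𝓘(ℝ, F × F'') ∞ (φ x) (φ x).source)
    (hφs : ∀ x, ContMDiffOn 𝓘(ℝ, F × F'') I ∞ (φ x).symm (φ x).target)
    (hg' : ∀ x, ∀ v ∈ (φ x).target, ∀ w ∈ (φ x).target, v.1 = w.1 →
      g ((φ x).symm v) = g ((φ x).symm w))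
    (hD : ∀ x j, D j ∩ (φ x).source = ∅ ∨ ∃ L : Submodule ℝ F'',
      D j ∩ (φ x).source = (φ x).source ∩
        (φ x) ⁻¹' ((⊤ : Submodule ℝ F).prod L : Set (F × F'')))
    (c : F) :
    ∃ X : Π x : N, TangentSpace I x,
      ContMDiff I I.tangent ∞ (fun x => (⟨x, X x⟩ : TangentBundle I N)) ∧
      (∀ x, mfderiv I 𝓘(ℝ, F) g x (X x) = c) ∧
      ∀ (x : N) (j : ι) (L : Submodule ℝ F''),
        D j ∩ (φ x).source = (φ x).source ∩
          (φ x) ⁻¹' ((⊤ : Submodule ℝ F).prod L : Set (F × F'')) →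
        ∀ y ∈ D j ∩ (φ x).source,
          mfderiv I 𝓘(ℝ, F × F'') (φ x) y (X y) ∈ (⊤ : Submodule ℝ F).prod L := by
  have h1le : (1 : WithTop ℕ∞) ≤ ∞ := by norm_cast
  -- the target conditions: lift `c`, and be tangent to the `D j` through the point in ITS chart
  set t : ∀ y : N, Set (TangentSpace I y) := fun y =>
    {v | mfderiv I 𝓘(ℝ, F) g y v = c ∧ ∀ (j : ι) (L : Submodule ℝ F''),
      D j ∩ (φ y).source = (φ y).source ∩
        (φ y) ⁻¹' ((⊤ : Submodule ℝ F).prod L : Set (F × F'')) → y ∈ D j →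
      mfderiv I 𝓘(ℝ, F × F'') (φ y) y v ∈ (⊤ : Submodule ℝ F).prod L} with ht
  have htc : ∀ y, Convex ℝ (t y) := by
    intro y v hv w hw a b _ _ hab
    refine ⟨?_, fun j L hL hyj => ?_⟩
    · rw [map_add, map_smul, map_smul, hv.1, hw.1, ← add_smul, hab, one_smul]
    · rw [map_add, map_smul, map_smul]
      exact Submodule.add_mem _ (Submodule.smul_mem _ _ (hv.2 j L hL hyj))
        (Submodule.smul_mem _ _ (hw.2 j L hL hyj))
  -- local sections with values in `t`
  have hloc : ∀ x₀ : N, ∃ U ∈ 𝓝 x₀, ∃ X : Π x : N, TangentSpace I x,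
      ContMDiffOn I (I.prod 𝓘(ℝ, EN)) ∞ (fun x => TotalSpace.mk' EN x (X x)) U ∧
      ∀ y ∈ U, X y ∈ t y := by
    intro x₀
    obtain ⟨U, hU, X, hXs, hXc, hUsrc, hX2⟩ :=
      exists_local_lift_tangent hg (hsurj x₀) (φ x₀) (hmem x₀) (hφ x₀) (hφs x₀) (hg' x₀) c
    refine ⟨U, hU, X, hXs, fun y hy => ⟨hXc y hy, fun j L hL hyj => ?_⟩⟩
    -- tangency in the chart at `x₀` (zero fibre component) transfers to the chart at `y`
    obtain ⟨L₀, hL₀⟩ := exists_straightening_of_mem hD hyj (hUsrc hy)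
    have hv : mfderiv I 𝓘(ℝ, F × F'') (φ x₀) y (X y) ∈ (⊤ : Submodule ℝ F).prod L₀ := by
      rw [Submodule.mem_prod]
      exact ⟨Submodule.mem_top, by rw [hX2 y hy]; exact Submodule.zero_mem _⟩
    exact mfderiv_mem_of_straightened ((hφ x₀).of_le h1le) ((hφs x₀).of_le h1le)
      ((hφ y).of_le h1le) hL₀ hL hyj (hUsrc hy) (hmem y) hv
  obtain ⟨s, hs⟩ := exists_contMDiffSection_forall_mem_convex_of_local (n := (⊤ : ℕ∞)) I
    (fun x => TangentSpace I x) t htc hloc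
  refine ⟨s, s.contMDiff, fun x => (hs x).1, fun x j L hL y hy => ?_⟩
  -- tangency at `y` in its own chart, transferred to the chart at `x`
  obtain ⟨L_y, hL_y⟩ := exists_straightening_of_mem hD hy.1 (hmem y)
  have hv : mfderiv I 𝓘(ℝ, F × F'') (φ y) y (s y) ∈ (⊤ : Submodule ℝ F).prod L_y :=
    (hs y).2 j L_y hL_y hy.1
  exact mfderiv_mem_of_straightened ((hφ y).of_le h1le) ((hφs y).of_le h1le)
    ((hφ x).of_le h1le) hL_y hL hy.1 (hmem y) hy.2 hv

end TangentLift

end Literature.Geometry.Manifold
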